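import Literature.NumberTheory.EllipticCurves.HeegnerModuleIndex
import Literature.NumberTheory.EllipticCurves.GreenbergSelmer
import Literature.NumberTheory.EllipticCurves.AnticyclotomicSignedHeegnerClasses
import Literature.NumberTheory.EllipticCurves.Rank1Residual.Predicates
import Literature.NumberTheory.EllipticCurves.GlobalMinimalModel
import Literature.NumberTheory.EllipticCurves.GaloisAction
import Literature.NumberTheory.DiophantineGeometry.Conductor
-- (route-free imports: every constant below is a Literature declaration; the binders of
--  `BetaEngineGoodSSApZeroThree` are copied from the R2 text of
--  `Summit.BirchSwinnertonDyer.BirchSwinnertonDyer.Theses.UniversalToricDescent.TwinAlgMuZeroAtThree`)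

/-!
# Sketch — crux idea `height-two-newton-signed-beta` on `UniversalToricDescent.TwinAlgMuZeroAtThree`
(stmt-BirchSwinnertonDyer-24737, filed under the crux dir of stmt-…-24254; planner bsd-wall-utd-idea g57,
2026-08-29)

First checkable statements of the idea card, typed over tree declarations. Nothing about BSD, the
crux or the route is proved or claimed here; the two `theorem`s are (1) the pure valuation-theoretic
heart of the one-layer Newton-polygon criterion and (2) the bookkeeping "signed layer indivisibility
at infinitely many layers of each parity ⟹ g51's K1 `LocalIndivisibleLayer`".

* Part 1 (`HeightTwoNewton`): on a height-two formal group with `a₃ = 0` one has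
  `[3]X = 3X·u(X) + c(X)·X⁹` with `u, c` units, so for a point `R` of valuation `r` the valuation of
  `[3]R` is `max(|3|·|R|, |R|⁹)` (multiplicative notation) whenever the two differ — the Newton polygon
  `{(1,1),(9,0)}` of `[3]`. `val_threeMul_add_ninth` is exactly this ultrametric computation.
* Part 2 (`SignedNewtonBeta`): the ENGINE statement on bucket C₀ (`GoodSS W′ 3 ∧ a₃(E′) = 0`) of the
  R2 text of stmt-24737, with the tree's trace-coherence predicate
  `HeegnerFamily.IsTraceCoherentApZero` (Castella–Wan Prop. 4.1) as the vertical relation and the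
  Manin-constant guard `¬ 3 ∣ F.Dt.c`; conclusion = local `3`-indivisibility at `𝔭` at infinitely
  many layers of EACH parity (`SignedLayerIndivisible`), which implies g51's K1 verbatim
  (`localIndivisibleLayer_of_signed`).
-/

noncomputable section

open scoped Classical

/-! ## Part 1. The Newton polygon of `[3]` on a height-two formal group: one valuation line -/

namespace Summit.BirchSwinnertonDyer.BirchSwinnertonDyer.Cruxes.TwinAlgMuZeroAtThree.HeightTwoNewton

/-- **Ultrametric heart of the one-layer criterion.** In any valued commutative ring, if `u` and `c`
are units for the valuation and `|3|·|R| ≠ |R|⁹`, then `|3·R·u + c·R⁹| = max(|3|·|R|, |R|⁹)`.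
Applied to `[3]_{Ê′}(R) = 3R·u(R) + c(R)·R⁹` (height two, `a₃ = 0`: `3 ∣ a_i` for `2 ≤ i ≤ 8`,
`a₉` a unit) over `K[3ⁿ]_𝔓` (ramification index `2·3ⁿ⁻¹`, never divisible by `8`, so the tie
`|R|⁸ = |3|` cannot occur) this says: a point of `Ê′` of normalised valuation `i/e` is `3`-divisible
in `Ê′(𝔪)` only if `9 ∣ i` (once `i < e`). -/
theorem val_threeMul_add_ninth {L Γ₀ : Type*} [CommRing L] [LinearOrderedCommGroupWithZero Γ₀]
    (v : Valuation L Γ₀) (R u c : L) (hu : v u = 1) (hc : v c = 1)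
    (hne : v 3 * v R ≠ v R ^ 9) :
    v (3 * R * u + c * R ^ 9) = max (v 3 * v R) (v R ^ 9) := by
  have h1 : v (3 * R * u) = v 3 * v R := by rw [map_mul, map_mul, hu, mul_one]
  have h2 : v (c * R ^ 9) = v R ^ 9 := by rw [map_mul, map_pow, hc, one_mul]
  rw [← h1, ← h2] at hne ⊢
  exact Valuation.map_add_of_distinct_val v hne

/-- The Newton dichotomy: under the same hypotheses the valuation of `3·R·u + c·R⁹` is EITHER
`|3|·|R|` OR `|R|⁹` (no cancellation, no intermediate value). -/
theorem val_threeMul_add_ninth_dichotomy {L Γ₀ : Type*} [CommRing L]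
    [LinearOrderedCommGroupWithZero Γ₀] (v : Valuation L Γ₀) (R u c : L) (hu : v u = 1)
    (hc : v c = 1) (hne : v 3 * v R ≠ v R ^ 9) :
    v (3 * R * u + c * R ^ 9) = v 3 * v R ∨ v (3 * R * u + c * R ^ 9) = v R ^ 9 := by
  rw [val_threeMul_add_ninth v R u c hu hc hne]
  exact max_choice _ _

end Summit.BirchSwinnertonDyer.BirchSwinnertonDyer.Cruxes.TwinAlgMuZeroAtThree.HeightTwoNewton

/-! ## Part 2. The engine statement on bucket C₀ of `TwinAlgMuZeroAtThree` -/

namespace Summit.BirchSwinnertonDyer.BirchSwinnertonDyer.Cruxes.TwinAlgMuZeroAtThree.SignedNewtonBeta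

open NumberField IsDedekindDomain Field WeierstrassCurve
open Literature.NumberTheory.EllipticCurves Literature.NumberTheory.EllipticCurves.GreenbergSelmer

/-- Local `3`-indivisibility of the layer point `z_k` at `𝔭`: every third `Q` of `z_k` with
`(Γ_{K_k} ∩ D_𝔭)`-rational `3Q` has non-zero mod-`3` Kummer class on `Γ_{K_k} ∩ D_𝔭`, i.e.
`z_k ∉ 3·E′(K_{k,w})` — the body of g51's K1 at ONE layer `k`. -/
def LayerIndivisibleAt {N' : ℕ} [NeZero N'] (W' : WeierstrassCurve ℚ) (K : Type) [Field K]
    [NumberField K] (κ : ZpExtension K 3) (jbar : AlgebraicClosure K →+* ℂ)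
    (F : HeegnerFamily N' W' K κ jbar) (𝔭 : HeightOneSpectrum (𝓞 K)) (k : ℕ) : Prop :=
  ∀ (Q : geomPoints (W'.baseChange K))
    (hQ : ∀ σ ∈ κ.layerSubgroup k ⊓ decomp 𝔭, σ • ((3 : ℤ) • Q) = (3 : ℤ) • Q),
    (3 : ℤ) • Q = F.z k →
      (W'.baseChange K).kummerClassOver (κ.layerSubgroup k ⊓ decomp 𝔭) 3 Q hQ ≠ 0

/-- g51's K1 `(β)` VERBATIM (card `local-indivisibility-road`, `LocalIndivisibleLayer`): SOME layer
point is locally `3`-indivisible at `𝔭`. -/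
def LocalIndivisibleLayer {N' : ℕ} [NeZero N'] (W' : WeierstrassCurve ℚ) (K : Type) [Field K]
    [NumberField K] (κ : ZpExtension K 3) (jbar : AlgebraicClosure K →+* ℂ)
    (F : HeegnerFamily N' W' K κ jbar) (𝔭 : HeightOneSpectrum (𝓞 K)) : Prop :=
  ∃ k : ℕ, LayerIndivisibleAt W' K κ jbar F 𝔭 k

/-- **Signed layer indivisibility** (what the signed road proves): for the sign `ε`, the layer
points `z_k` of parity `ε` (`(-1)^k = ε`) are locally `3`-indivisible at `𝔭` for INFINITELY MANY
`k` — the finite-layer shadow of "`loc_𝔭 z^ε_∞ ∉ 3·H¹_ε(K_𝔭, 𝐓^ac)`", obtained from the signed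
explicit reciprocity law `Log^ε(loc_𝔭 z^ε_∞) = 𝓛_𝔭^BDP · F_d · σ` (Castella–Wan Thm. 5.6, printed
for `p > 3`; port at `3`) and `μ(𝓛_𝔭^BDP) = 0` (Hsieh Thm. B, tree fact
`Hsieh2014.thmB_exists_isHsiehLFunction_coeff_norm_eq_one_unrPeriod_anyLevel`, printed at `3 ∤ N′`)
by `ω^ε_n`-division in the free module `H¹(K_{n,𝔭}, T) ≅ Λ_n²`. -/
def SignedLayerIndivisible {N' : ℕ} [NeZero N'] (W' : WeierstrassCurve ℚ) (K : Type) [Field K]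
    [NumberField K] (κ : ZpExtension K 3) (jbar : AlgebraicClosure K →+* ℂ)
    (F : HeegnerFamily N' W' K κ jbar) (𝔭 : HeightOneSpectrum (𝓞 K)) (ε : ℤˣ) : Prop :=
  ∀ k₀ : ℕ, ∃ k : ℕ, k₀ ≤ k ∧ (-1 : ℤˣ) ^ k = ε ∧ LayerIndivisibleAt W' K κ jbar F 𝔭 k

/-- Bookkeeping: signed layer indivisibility for any one sign gives g51's K1. -/
theorem localIndivisibleLayer_of_signed {N' : ℕ} [NeZero N'] {W' : WeierstrassCurve ℚ} {K : Type}
    [Field K] [NumberField K] {κ : ZpExtension K 3} {jbar : AlgebraicClosure K →+* ℂ}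
    {F : HeegnerFamily N' W' K κ jbar} {𝔭 : HeightOneSpectrum (𝓞 K)} {ε : ℤˣ}
    (h : SignedLayerIndivisible W' K κ jbar F 𝔭 ε) : LocalIndivisibleLayer W' K κ jbar F 𝔭 := by
  obtain ⟨k, -, -, hk⟩ := h 0
  exact ⟨k, hk⟩

/-- **THE ENGINE (card `height-two-newton-signed-beta`).** On bucket C₀ of `TwinAlgMuZeroAtThree`
(binders copied from the R2 text of stmt-24737, second disjunct: `GoodSS W′ 3 ∧ a₃(E′) = 0`,
`ρ̄_{E′,3}` onto, `cond E′ = N′`, `K` imaginary quadratic Heegner for `N′` with `d_K` odd, `κ`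
anticyclotomic, `𝔭 ∣ 3` of ramification index and inertia degree one), every TRACE-COHERENT
(`Tr_{K_{n+2}/K_{n+1}} z_{n+2} = −z_n`, the `a₃ = 0` relation, tree predicate
`HeegnerFamily.IsTraceCoherentApZero`) Heegner family whose parametrisation datum has Manin
constant prime to `3` is locally `3`-indivisible at `𝔭` at infinitely many layers of EACH parity.
Mechanism: (i) the localised tower is Kobayashi's admissible norm system `𝔾(t_n)` on the ordinary
CM disc (Kobayashi 2013 Thm. 1.5 / Prop. 5.1, any good supersingular `p`), `t_n` a uniformizer of
`K[3ⁿ]_𝔓`; (ii) Newton polygon of `[3]` (Part 1): one-layer criterion `9 ∣ ord_t 𝔾̄`; (iii)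
class-wide: signed logarithm integrality + Castella–Wan Thm. 5.6 (port `p > 3 ⟶ 3`) + Hsieh Thm. B. -/
def BetaEngineGoodSSApZeroThree : Prop :=
  ∀ (W' : WeierstrassCurve ℚ) [W'.IsElliptic] [W'.IsGloballyMinimal] (N' : ℕ) [NeZero N']
    (K : Type) [Field K] [NumberField K],
    Rank1Residual.GoodSS W' 3 → W'.frobeniusTrace 3 = 0 →
    W'.HasSurjectiveModNGaloisRep 3 → W'.conductorNorm ℤ = N' → IsImaginaryQuadratic K →
    SatisfiesHeegnerHypothesis N' K → Odd (NumberField.discr K) →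
    ∀ (κ : ZpExtension K 3), κ.IsAnticyclotomic →
    ∀ (𝔭 : HeightOneSpectrum (𝓞 K)), ((3 : ℕ) : 𝓞 K) ∈ 𝔭.asIdeal →
      𝔭.asIdeal.ramificationIdx (𝓞 ℚ) = 1 → 𝔭.asIdeal.inertiaDeg (𝓞 ℚ) = 1 →
    ∀ (jbar : AlgebraicClosure K →+* ℂ) (F : HeegnerFamily N' W' K κ jbar),
      ¬ (3 : ℤ) ∣ F.Dt.c → F.IsTraceCoherentApZero →
      ∀ ε : ℤˣ, SignedLayerIndivisible W' K κ jbar F 𝔭 ε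

/-- The engine implies g51's K1 on bucket C₀ (pure bookkeeping, proved). -/
theorem localIndivisibleLayer_of_engine (h : BetaEngineGoodSSApZeroThree)
    (W' : WeierstrassCurve ℚ) [W'.IsElliptic] [W'.IsGloballyMinimal] (N' : ℕ) [NeZero N']
    (K : Type) [Field K] [NumberField K]
    (hss : Rank1Residual.GoodSS W' 3) (ha : W'.frobeniusTrace 3 = 0)
    (hsurj : W'.HasSurjectiveModNGaloisRep 3) (hN : W'.conductorNorm ℤ = N')
    (hK : IsImaginaryQuadratic K) (hH : SatisfiesHeegnerHypothesis N' K)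
    (hd : Odd (NumberField.discr K)) (κ : ZpExtension K 3) (hκ : κ.IsAnticyclotomic)
    (𝔭 : HeightOneSpectrum (𝓞 K)) (h𝔭 : ((3 : ℕ) : 𝓞 K) ∈ 𝔭.asIdeal)
    (he : 𝔭.asIdeal.ramificationIdx (𝓞 ℚ) = 1) (hf : 𝔭.asIdeal.inertiaDeg (𝓞 ℚ) = 1)
    (jbar : AlgebraicClosure K →+* ℂ) (F : HeegnerFamily N' W' K κ jbar)
    (hc : ¬ (3 : ℤ) ∣ F.Dt.c) (htr : F.IsTraceCoherentApZero) :
    LocalIndivisibleLayer W' K κ jbar F 𝔭 :=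
  localIndivisibleLayer_of_signed
    (h W' N' K hss ha hsurj hN hK hH hd κ hκ 𝔭 h𝔭 he hf jbar F hc htr 1)

end Summit.BirchSwinnertonDyer.BirchSwinnertonDyer.Cruxes.TwinAlgMuZeroAtThree.SignedNewtonBeta

/-! ## Part 3. The algebraic core of K2″ (ω^ε-division): pure commutative algebra, PROVED

In `H¹(K_𝔭, 𝕋^ac) ≅ Λ^ι` (free; C–W Lemma 5.3) write `ω_n = ω_n^ε · ω̃_n^{-ε}` =: `a · b` and `p = 3`.  A layer class
killed by `ω_n^ε` has the form `loc z_n = b • x` (`x` = the level-`n` approximation of the signed class `z^ε`).  The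
step «`loc z_n ∈ 3·H¹(K_{n,𝔭},T) = 3·(M/ω_n M)` ⟹ `x ∈ 3·(M/ω_n^ε M)`» is, after lifting to `M = Λ^ι`, exactly the
following statement, whose only inputs are: `b` is a non-zero-divisor and `b` is prime to `p` in the divisor sense
(`b ∣ p·m → b ∣ m`; true in the UFD `ℤ₃⟦T⟧` for the distinguished polynomial `ω̃_n^{-ε}`, which is `≢ 0 mod 3`). -/

namespace Summit.BirchSwinnertonDyer.BirchSwinnertonDyer.Cruxes.TwinAlgMuZeroAtThree.OmegaDivision

/-- **ω-division core (K2″, algebraic half).** In a commutative ring, let `b` be a non-zero-divisor with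
`b ∣ p·m → b ∣ m` for all `m`. If a vector `x : ι → Λ` satisfies `b·x = p·m + a·b·m′` componentwise (i.e.
`b • x ∈ p·M + (a b)·M` in the free module `M = Λ^ι`), then `x ∈ a·M + p·M`: `x = a·m′ + p·m″`. -/
theorem exists_eq_add_of_mul_eq {Λ ι : Type*} [CommRing Λ] (a b p : Λ)
    (hb : ∀ y : Λ, b * y = 0 → y = 0) (hcop : ∀ m : Λ, b ∣ p * m → b ∣ m)
    (x m m' : ι → Λ) (h : ∀ i, b * x i = p * m i + a * b * m' i) :
    ∃ m'' : ι → Λ, ∀ i, x i = a * m' i + p * m'' i := by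
  have key : ∀ i, ∃ t : Λ, x i = a * m' i + p * t := by
    intro i
    have h1 : b * (x i - a * m' i) = p * m i := by linear_combination h i
    obtain ⟨t, ht⟩ := hcop (m i) ⟨x i - a * m' i, h1.symm⟩
    refine ⟨t, ?_⟩
    have h2 : b * (x i - a * m' i - p * t) = 0 := by
      rw [ht] at h1
      linear_combination h1
    have h3 := hb _ h2
    linear_combination h3
  exact ⟨fun i => Classical.choose (key i), fun i => Classical.choose_spec (key i)⟩

/-- The same, phrased with module operations on `ι → Λ`: `b • x = p • m + (a * b) • m′ ⟹ ∃ m″, x = a • m′ + p • m″`. -/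
theorem exists_eq_smul_add_smul {Λ ι : Type*} [CommRing Λ] (a b p : Λ)
    (hb : ∀ y : Λ, b * y = 0 → y = 0) (hcop : ∀ m : Λ, b ∣ p * m → b ∣ m)
    (x m m' : ι → Λ) (h : b • x = p • m + (a * b) • m') :
    ∃ m'' : ι → Λ, x = a • m' + p • m'' := by
  have h' : ∀ i, b * x i = p * m i + a * b * m' i := by
    intro i
    have := congrArg (fun f => f i) h
    simpa [Pi.smul_apply, Pi.add_apply, smul_eq_mul] using this
  obtain ⟨m'', hm''⟩ := exists_eq_add_of_mul_eq a b p hb hcop x m m' h'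
  refine ⟨m'', funext fun i => ?_⟩
  simpa [Pi.smul_apply, Pi.add_apply, smul_eq_mul] using hm'' i

end Summit.BirchSwinnertonDyer.BirchSwinnertonDyer.Cruxes.TwinAlgMuZeroAtThree.OmegaDivision

end
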